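import Summits.QuantumFields.YangMills.Theorems.UnitScaleTiltProp7ClosedFibreMinimiser
import HarnessLib

/-!
# Route `UnitScaleTilt`, crux K1 child «MinimiserStabilityRegPr» (stmt-QuantumFields-19200), skeleton v9 ∕ line route-R — THE EXISTENCE STUB
# `stub_existenceMinimalOrbit` ([Balaban1985Variational] Prop. 7, existence clause, from a background (14)) ON ROUTE (β), THE DIRECT METHOD:
# (1) the registered «∀ B₃ > 4» costs nothing — existence at ONE `B₃* > 0` gives it at every `B₃`; (2) the interiority sentence of
# `Prop7ClosedFibreMinimiser` ⇐ ONE displayed a-priori estimate, the CLOSED-FIBRE SIBLING of the registered halving stub `stub_halvingStep`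
# («a minimiser of (5) over the CLOSED regular fibre (6̄)(ε₀) lies in 𝔘_k(max{B₃ε₁, ½ε₀})», Prop. 8 ∕ Sect. F p. 304 read for KKT points);
# (3) what the registered (open) halving itself buys: existence at radius `e` as soon as ONE closed-fibre minimiser at some radius `σ ∈ [e, 2e]`
# is interior — the only obstruction to existence given `stub_halvingStep` is BOUNDARY STICKING

Cell `ym3-torus`, width seat `ym-ust-19200-w4` (gen 0; OWNER RULING g24-№3′ (4): «w4 := `stub_existenceMinimalOrbit`, route (β) first … plus the INTERIORITY
lemma … by a KKT-halving argument adjacent to `stub_halvingStep`»).  Builds BY NAME on width seat 20520-w4's `Prop7ClosedFibreMinimiser` (p591314: the closed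
regular fibre `(6̄)(e) ∩ 𝔅_k(V)` inline, compactness, `exists_isMinOn_closedRegFibre_of_background`, `isMinOn_regFibrePr_of_interior`, `isCritR2_of_interior`,
`existenceMinimalOrbit_of_interior`).  THEOREMS ONLY (0 `def`, 0 `sorry`); YM₃ on T³ is a ladder rung (R3), not the Clay problem; nothing here claims the stub,
the crux, d = 4 or the mass gap.

WHAT IS PROVED (ns `…Theorems.Prop7ClosedFibreHalving`).
§1 **`existenceMinimalOrbit_allB₃_of_one`** — the `stub_existenceMinimalOrbit` text (∀ L > 1, ∀ B₃ > 4, ∃ a′₁ O₁ …) from the SAME text at a single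
   `B₃* > 0` per `L` (for `B₃ < B₃*` enlarge `O₁` by `B₃*/B₃` and use `𝔘_k(L³B₃ε₁) ⊆ 𝔘_k(L³B₃*ε₁)`; for `B₃ ≥ B₃*` shrink `a′₁` by `B₃*/B₃` and read the
   (7)-datum at `ε₁* = B₃ε₁/B₃* ≥ ε₁`): so a supplier may work at the existential `B₃` of `stub_halvingStep` ∕ (162).
§2 **`interior_of_closedHalving`** (member level) and ★ **`existenceMinimalOrbit_of_closedHalving`**: the displayed sentence CLOSED-HALVING(L, B₃, a₅) —
   «for every member, every `0 < ε₁`, `0 < ε₀ ≤ a₅`, every (7)-datum `V`, every minimiser `Ū` of the Wilson action over `(6̄)(ε₀) ∩ 𝔅_k(V)`: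
   `Ū ∈ 𝔘_k(max{B₃ε₁, ½ε₀})`» (the binder shape of `T3Thm1CarrierNative.HalvingNativeAt` with «R2-critical point of the OPEN fibre» replaced by «minimiser over
   the CLOSED fibre») — gives the interiority sentence `hInt` of `Prop7ClosedFibreMinimiser.existenceMinimalOrbit_of_interior` with `O₁ = 2`,
   `a′₁ = a₅/(2L³B₃)` (a closed minimiser at `e = 2L³B₃ε₁ ≤ a₅` lies in `𝔘_k(max{B₃ε₁, L³B₃ε₁}) ⊆ 𝔘_k(e)`), hence, with §1 and the admissibility shrink of
   p591314 §4, THE REGISTERED TEXT: `(∀ L > 1, ∃ B₃ a₅ > 0, CLOSED-HALVING(L, B₃, a₅)) → stub_existenceMinimalOrbit`.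
§3 **`exists_isMinOn_regFibrePr_of_halving_of_interiorAt`** — what the REGISTERED halving (`HalvingNativeAt L a₅ B₃`, = `stub_halvingStep` unfolded,
   `T3Thm1CarrierNative.halvingStep_famX_iff_native`) buys on route (β): if some minimiser `Ū` over the closed fibre `(6̄)(σ) ∩ 𝔅_k(V)` at SOME radius
   `σ ∈ [e, 2e]`, `σ ≤ a₅`, `B₃ε₁ ≤ e`, is interior (`Ū ∈ 𝔘_k(σ)`), then `Ū` is R2-critical, the halving puts it in `𝔘_k(max{B₃ε₁, ½σ}) ⊆ 𝔘_k(e)`, and `Ū`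
   minimises over print's OPEN space (6)(e) ⊆ (6̄)(σ): existence at radius `e`.  So, GIVEN `stub_halvingStep`, the only obstruction to the existence stub is
   BOUNDARY STICKING (every closed-fibre minimiser at every radius of `[e, 2e]` on the shell); no soft argument excludes it (the closed minimum `m̄(σ)` may be
   strictly decreasing and continuous in `σ`), which is why §2's sentence is a genuine a-priori estimate.

LOCATED REMARK (owner's call): CLOSED-HALVING is the KKT form of print's Sect. F (p. 304 «hence U_k belongs to the space (2) with max{B₃ε₁, ½ε₀} instead of ε₀»):
at a closed-fibre minimiser the Euler–Lagrange EQUALITY (158) of a critical point becomes stationarity of the RE-WEIGHTED action `Σ_p (1 + 4μ_p)·A_p`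
(`μ_p ≥ 0` supported on the active plaquette shell, `dg_p = 4·dA_p` for `g_p = |U(∂p) − 1|² − ε₀²L^{−4k}`) plus the divergence-shell multipliers; the cell's
last mile `Prop8LastMile` (w3 g0) is predicate-agnostic, so CLOSED-HALVING ⇐ the same per-site local charts (167) once the junction (158) is available for
KKT points.  Nothing of this is claimed here.

HONEST SCOPE.  Bookkeeping (monotonicity of `RegPr` ∕ `PlaqSmall` in the radius, the extreme-value theorem of p591314, radius arithmetic); CLOSED-HALVING
and `HalvingNativeAt` are displayed hypotheses, not proved; nothing of [Balaban1985Variational] is asserted; `--supports stmt-QuantumFields-19200`, count-neutral.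

References: T. Bałaban, CMP 102 (1985) 277–309 [Balaban1985Variational] ((2)–(8) p.278, Thm 1 p.279, (14) p.280, Prop. 7 p.299, Prop. 8 and Sect. F p.304);
CMP 98 (1985) 17–51 [Balaban1985Averaging] ((53) p.26).
-/

set_option autoImplicit false

noncomputable section

namespace Summit.QuantumFields.YangMills.Theorems.Prop7ClosedFibreHalving

open Set Filter Topology
open scoped Matrix.Norms.L2Operator
open Literature.MathematicalPhysics.QuantumFieldTheory.Balaban1983to89
open Literature.MathematicalPhysics.QuantumFieldTheory.Balaban1983to89.T3ContinuumYM3Torus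
open Literature.MathematicalPhysics.QuantumFieldTheory.Balaban1983to89.T3UnitLawDensityEML (ℰp)
open Literature.MathematicalPhysics.QuantumFieldTheory.Balaban1983to89.T3PrintedRegularMinimiser (RegPr DivSmall regFibrePr mem_regFibrePr_iff)
open Literature.MathematicalPhysics.QuantumFieldTheory.Balaban1983to89.T3PrintedMinimiserExistence (regFibrePr_mono regThreshold_mono regPr_mono
  plaqSmall_of_le)
open Literature.MathematicalPhysics.QuantumFieldTheory.Balaban1983to89.T3RegularMinimiser (regThreshold regFibre)
open Literature.MathematicalPhysics.QuantumFieldTheory.Balaban1983to89.T3ConstrainedMinimiser (fibre)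
open Literature.MathematicalPhysics.QuantumFieldTheory.Balaban1983to89.T3TiltDescent (descendTo)
open Literature.MathematicalPhysics.QuantumFieldTheory.Balaban1983to89.T3Thm1CarrierNative (IsCritR2 isCritR2_of_isMinOn HalvingNativeAt)
open Literature.MathematicalPhysics.QuantumFieldTheory.Balaban1983to89.B10Eq27TorusAxialLog (toUField unitsField)
open Literature.MathematicalPhysics.QuantumFieldTheory.Balaban1983to89.B10Eq68TorusRegularity (covDivT)
open Literature.MathematicalPhysics.QuantumFieldTheory.Balaban1983to89.ExpMeanLog (deltaSU deltaSU_pos)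
open Summit.QuantumFields.YangMills.Theorems.Prop7ClosedFibreMinimiser (regFibrePr_subset_closedRegFibre closedRegFibre_subset_regFibrePr
  exists_isMinOn_closedRegFibre_of_background isMinOn_regFibrePr_of_interior isCritR2_of_interior existenceMinimalOrbit_of_interior)

/-! ## §1 The registered «∀ B₃ > 4» from existence at one `B₃*` -/

section Monotone

/-- **EXISTENCE AT ONE `B₃* > 0` GIVES THE REGISTERED TEXT AT EVERY `B₃ > 4`.**  If for every block size `L > 1` there are `B₃* > 0`, `a′₁ > 0`, `O₁ ≥ 1` with
the body of `stub_existenceMinimalOrbit` at `B₃*` (every member, every `0 < ε₁ ≤ a′₁`, every (7)-datum `V` with a background `U₀ ∈ 𝔘_k(L³B₃*ε₁) ∩ 𝔅_k(V)`: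
a minimiser of (5) over (6)(O₁L³B₃*ε₁)), then the text holds ∀ `B₃ > 4` with `a″₁ = a′₁·min{1, B₃*/B₃}`, `O′₁ = O₁·max{1, B₃*/B₃}`: for `B₃ ≥ B₃*` read the
datum at `ε₁* = B₃ε₁/B₃* ≥ ε₁` ((7) is monotone in `ε₁`), for `B₃ < B₃*` use `𝔘_k(L³B₃ε₁) ⊆ 𝔘_k(L³B₃*ε₁)` — in both cases the radius `O₁L³B₃*ε₁*` IS
`O′₁L³B₃ε₁`. [cite: Balaban1985Variational, Prop. 7 p.299, (7) p.278, (14) p.280] -/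
theorem existenceMinimalOrbit_allB₃_of_one
    (hone : ∀ L : ℕ, 1 < L → ∃ Bs a₁' O₁ : ℝ, 0 < Bs ∧ 0 < a₁' ∧ 1 ≤ O₁ ∧
      ∀ F : T3Family, F.L = L → ∀ (n K : ℕ) (hnK : n < K) (ε₁ : ℝ), 0 < ε₁ →
        ∀ V : GaugeField (F.P n) 0 (Matrix.specialUnitaryGroup (Fin 2) ℂ), PlaqSmall ε₁ V →
          ∀ U₀ : GaugeField (F.P K) 0 (Matrix.specialUnitaryGroup (Fin 2) ℂ), RegPr F n K ((L : ℝ) ^ 3 * Bs * ε₁) U₀ →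
            U₀ ∈ fibre F ℰp n K hnK.le V → ε₁ ≤ a₁' →
              ∃ U ∈ regFibrePr F n K hnK.le (O₁ * (L : ℝ) ^ 3 * Bs * ε₁) V,
                IsMinOn (fun W : GaugeField (F.P K) 0 (Matrix.specialUnitaryGroup (Fin 2) ℂ) => wilsonAction4 W)
                  (regFibrePr F n K hnK.le (O₁ * (L : ℝ) ^ 3 * Bs * ε₁) V) U) :
    ∀ L : ℕ, 1 < L → ∀ B₃ : ℝ, 4 < B₃ → ∃ a₁' O₁ : ℝ, 0 < a₁' ∧ 1 ≤ O₁ ∧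
      ∀ F : T3Family, F.L = L → ∀ (n K : ℕ) (hnK : n < K) (ε₁ : ℝ), 0 < ε₁ →
        ∀ V : GaugeField (F.P n) 0 (Matrix.specialUnitaryGroup (Fin 2) ℂ), PlaqSmall ε₁ V →
          ∀ U₀ : GaugeField (F.P K) 0 (Matrix.specialUnitaryGroup (Fin 2) ℂ), RegPr F n K ((L : ℝ) ^ 3 * B₃ * ε₁) U₀ →
            U₀ ∈ fibre F ℰp n K hnK.le V → ε₁ ≤ a₁' →
              ∃ U ∈ regFibrePr F n K hnK.le (O₁ * (L : ℝ) ^ 3 * B₃ * ε₁) V,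
                IsMinOn (fun W : GaugeField (F.P K) 0 (Matrix.specialUnitaryGroup (Fin 2) ℂ) => wilsonAction4 W)
                  (regFibrePr F n K hnK.le (O₁ * (L : ℝ) ^ 3 * B₃ * ε₁) V) U := by
  intro L hL B₃ hB₃
  obtain ⟨Bs, a₁', O₁, hBs, ha₁', hO₁, H⟩ := hone L hL
  have hB₃0 : 0 < B₃ := by linarith
  have hL0 : (0 : ℝ) < (L : ℝ) := by exact_mod_cast (show 0 < L by omega)
  have hq : 0 < Bs / B₃ := div_pos hBs hB₃0
  have hBs0 : Bs ≠ 0 := hBs.ne'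
  have hB₃ne : B₃ ≠ 0 := hB₃0.ne'
  refine ⟨a₁' * min 1 (Bs / B₃), O₁ * max 1 (Bs / B₃), mul_pos ha₁' (lt_min one_pos hq),
    one_le_mul_of_one_le_of_one_le hO₁ (le_max_left _ _), ?_⟩
  intro F hF n K hnK ε₁ hε₁ V hV U₀ hreg hfib hε₁a
  rcases le_or_gt Bs B₃ with hle | hlt
  · -- `B₃ ≥ B₃*`: read the (7)-datum at `ε₁* = B₃ε₁/B₃* ≥ ε₁`
    have hq1 : Bs / B₃ ≤ 1 := (div_le_one hB₃0).2 hle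
    have hmin1 : min 1 (Bs / B₃) = Bs / B₃ := min_eq_right hq1
    have hmax1 : max 1 (Bs / B₃) = 1 := max_eq_left hq1
    have hε₁s : 0 < B₃ * ε₁ / Bs := by positivity
    have hε₁le : ε₁ ≤ B₃ * ε₁ / Bs := by
      rw [le_div_iff₀ hBs]; nlinarith
    have hVs : PlaqSmall (B₃ * ε₁ / Bs) V := plaqSmall_of_le hε₁le hV
    have hε₁sa : B₃ * ε₁ / Bs ≤ a₁' := by
      rw [hmin1] at hε₁a
      rw [div_le_iff₀ hBs]
      have := mul_le_mul_of_nonneg_left hε₁a hB₃0.le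
      calc B₃ * ε₁ ≤ B₃ * (a₁' * (Bs / B₃)) := this
        _ = a₁' * Bs := by field_simp
    have hrad0 : (L : ℝ) ^ 3 * Bs * (B₃ * ε₁ / Bs) = (L : ℝ) ^ 3 * B₃ * ε₁ := by field_simp
    have hregs : RegPr F n K ((L : ℝ) ^ 3 * Bs * (B₃ * ε₁ / Bs)) U₀ := by rw [hrad0]; exact hreg
    obtain ⟨U, hU, hUmin⟩ := H F hF n K hnK (B₃ * ε₁ / Bs) hε₁s V hVs U₀ hregs hfib hε₁sa
    have hrad : O₁ * (L : ℝ) ^ 3 * Bs * (B₃ * ε₁ / Bs) = O₁ * max 1 (Bs / B₃) * (L : ℝ) ^ 3 * B₃ * ε₁ := by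
      rw [hmax1]; field_simp
    rw [hrad] at hU hUmin
    exact ⟨U, hU, hUmin⟩
  · -- `B₃ < B₃*`: enlarge `O₁` by `B₃*/B₃` and use `𝔘_k(L³B₃ε₁) ⊆ 𝔘_k(L³B₃*ε₁)`
    have hq1 : 1 ≤ Bs / B₃ := (one_le_div hB₃0).2 hlt.le
    have hmin1 : min 1 (Bs / B₃) = 1 := min_eq_left hq1
    have hmax1 : max 1 (Bs / B₃) = Bs / B₃ := max_eq_right hq1
    rw [hmin1, mul_one] at hε₁a
    have hmono : (L : ℝ) ^ 3 * B₃ * ε₁ ≤ (L : ℝ) ^ 3 * Bs * ε₁ := by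
      have : 0 ≤ (L : ℝ) ^ 3 * ε₁ := by positivity
      nlinarith
    obtain ⟨U, hU, hUmin⟩ := H F hF n K hnK ε₁ hε₁ V hV U₀ (regPr_mono F hmono hreg) hfib hε₁a
    have hrad : O₁ * (L : ℝ) ^ 3 * Bs * ε₁ = O₁ * max 1 (Bs / B₃) * (L : ℝ) ^ 3 * B₃ * ε₁ := by
      rw [hmax1]; field_simp
    rw [hrad] at hU hUmin
    exact ⟨U, hU, hUmin⟩

end Monotone

/-! ## §2 The interiority sentence from CLOSED-HALVING, and the registered text from it -/

section ClosedHalving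

/-- **INTERIORITY FROM CLOSED-HALVING, MEMBER LEVEL.**  If at the member `F` every minimiser of the Wilson action over the closed fibre
`(6̄)(ε₀) ∩ 𝔅_k(V)`, `V` a (7)-datum at `ε₁ > 0`, `0 < ε₀ ≤ a₅`, lies in `𝔘_k(max{B₃ε₁, ½ε₀})` (the closed-fibre sibling of [Balaban1985Variational] Prop. 8's
halving step), then the interiority sentence `hInt` of `Prop7ClosedFibreMinimiser.existenceMinimalOrbit_of_interior` holds with `O₁ = 2`, `a′₁ = a₅/(2L³B₃)`:
a closed-fibre minimiser at radius `e = 2L³B₃ε₁ ≤ a₅` lies in `𝔘_k(max{B₃ε₁, L³B₃ε₁}) ⊆ 𝔘_k(e)`. [cite: Balaban1985Variational, Prop. 8 and Sect. F p.304, Prop. 7 p.299] -/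
theorem interior_of_closedHalving (F : T3Family) {B₃ a₅ : ℝ} (hB₃ : 0 < B₃)
    (hCH : ∀ (n K : ℕ) (hnK : n < K) (ε₀ ε₁ : ℝ), 0 < ε₁ → 0 < ε₀ → ε₀ ≤ a₅ →
      ∀ V : GaugeField (F.P n) 0 (Matrix.specialUnitaryGroup (Fin 2) ℂ), PlaqSmall ε₁ V →
        ∀ Ū : GaugeField (F.P K) 0 (Matrix.specialUnitaryGroup (Fin 2) ℂ),
          Ū ∈ {U : GaugeField (F.P K) 0 (Matrix.specialUnitaryGroup (Fin 2) ℂ) | ∀ p : Plaq (F.P K) 0,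
                GaugeGroup.dist1 (GaugeField.plaqHol U p) ≤ regThreshold F n K ε₀} ∩ descendTo F ℰp n K hnK.le ⁻¹' {V} ∩
              {U | ∀ b : PBond (F.P K) 0, ‖covDivT 1 (unitsField (toUField U)) b.dir b.src‖ ≤ ε₀ * ((F.L : ℝ)⁻¹) ^ (3 * (K - n))} →
          IsMinOn (fun W : GaugeField (F.P K) 0 (Matrix.specialUnitaryGroup (Fin 2) ℂ) => wilsonAction4 W)
            ({U : GaugeField (F.P K) 0 (Matrix.specialUnitaryGroup (Fin 2) ℂ) | ∀ p : Plaq (F.P K) 0,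
                GaugeGroup.dist1 (GaugeField.plaqHol U p) ≤ regThreshold F n K ε₀} ∩ descendTo F ℰp n K hnK.le ⁻¹' {V} ∩
              {U | ∀ b : PBond (F.P K) 0, ‖covDivT 1 (unitsField (toUField U)) b.dir b.src‖ ≤ ε₀ * ((F.L : ℝ)⁻¹) ^ (3 * (K - n))}) Ū →
          RegPr F n K (max (B₃ * ε₁) (ε₀ / 2)) Ū) :
    ∀ (n K : ℕ) (hnK : n < K) (ε₁ : ℝ), 0 < ε₁ → ε₁ ≤ a₅ / (2 * (F.L : ℝ) ^ 3 * B₃) →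
      ∀ V : GaugeField (F.P n) 0 (Matrix.specialUnitaryGroup (Fin 2) ℂ), PlaqSmall ε₁ V →
        ∀ U₀ : GaugeField (F.P K) 0 (Matrix.specialUnitaryGroup (Fin 2) ℂ), RegPr F n K ((F.L : ℝ) ^ 3 * B₃ * ε₁) U₀ →
          U₀ ∈ fibre F ℰp n K hnK.le V →
          ∀ Ū : GaugeField (F.P K) 0 (Matrix.specialUnitaryGroup (Fin 2) ℂ),
            Ū ∈ {U : GaugeField (F.P K) 0 (Matrix.specialUnitaryGroup (Fin 2) ℂ) | ∀ p : Plaq (F.P K) 0,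
                  GaugeGroup.dist1 (GaugeField.plaqHol U p) ≤ regThreshold F n K (2 * (F.L : ℝ) ^ 3 * B₃ * ε₁)} ∩
                descendTo F ℰp n K hnK.le ⁻¹' {V} ∩
                {U | ∀ b : PBond (F.P K) 0, ‖covDivT 1 (unitsField (toUField U)) b.dir b.src‖ ≤
                  (2 * (F.L : ℝ) ^ 3 * B₃ * ε₁) * ((F.L : ℝ)⁻¹) ^ (3 * (K - n))} →
            IsMinOn (fun W : GaugeField (F.P K) 0 (Matrix.specialUnitaryGroup (Fin 2) ℂ) => wilsonAction4 W)
              ({U : GaugeField (F.P K) 0 (Matrix.specialUnitaryGroup (Fin 2) ℂ) | ∀ p : Plaq (F.P K) 0,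
                  GaugeGroup.dist1 (GaugeField.plaqHol U p) ≤ regThreshold F n K (2 * (F.L : ℝ) ^ 3 * B₃ * ε₁)} ∩
                descendTo F ℰp n K hnK.le ⁻¹' {V} ∩
                {U | ∀ b : PBond (F.P K) 0, ‖covDivT 1 (unitsField (toUField U)) b.dir b.src‖ ≤
                  (2 * (F.L : ℝ) ^ 3 * B₃ * ε₁) * ((F.L : ℝ)⁻¹) ^ (3 * (K - n))}) Ū →
            RegPr F n K (2 * (F.L : ℝ) ^ 3 * B₃ * ε₁) Ū := by
  intro n K hnK ε₁ hε₁ hε₁a V hV U₀ _hreg _hfib Ū hŪ hmin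
  have hL1 : (1 : ℝ) ≤ (F.L : ℝ) := by have := F.hL.2; exact_mod_cast (by omega : 1 ≤ F.L)
  have hL3 : (1 : ℝ) ≤ (F.L : ℝ) ^ 3 := one_le_pow₀ hL1
  have hD : 0 < 2 * (F.L : ℝ) ^ 3 * B₃ := by positivity
  -- the radius `e = 2L³B₃ε₁` is positive and at most `a₅`
  have he0 : 0 < 2 * (F.L : ℝ) ^ 3 * B₃ * ε₁ := by positivity
  have hea : 2 * (F.L : ℝ) ^ 3 * B₃ * ε₁ ≤ a₅ := by
    have := (le_div_iff₀ hD).1 hε₁a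
    linarith
  have hhalf := hCH n K hnK (2 * (F.L : ℝ) ^ 3 * B₃ * ε₁) ε₁ hε₁ he0 hea V hV Ū hŪ hmin
  -- `max{B₃ε₁, L³B₃ε₁} ≤ 2L³B₃ε₁`
  refine regPr_mono F (max_le ?_ ?_) hhalf
  · have : 0 ≤ B₃ * ε₁ := by positivity
    nlinarith
  · linarith

/-- ★ **THE REGISTERED EXISTENCE STUB FROM CLOSED-HALVING.**  If for every block size `L > 1` there are `B₃, a₅ > 0` such that CLOSED-HALVING(L, B₃, a₅) holds —
«for every member of the family with `F.L = L`, every `0 < ε₁`, `0 < ε₀ ≤ a₅`, every (7)-datum `V` and every minimiser `Ū` of the Wilson action over the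
closed regular fibre `(6̄)(ε₀) ∩ 𝔅_k(V)`: `Ū ∈ 𝔘_k(max{B₃ε₁, ½ε₀})`» (the binder shape of `T3Thm1CarrierNative.HalvingNativeAt`, i.e. of `stub_halvingStep`,
with «R2-critical point of the open fibre» replaced by «minimiser over the closed fibre»; [Balaban1985Variational] Sect. F p. 304 read at KKT points) — then the
text of `stub_existenceMinimalOrbit` (skeleton v9 ∕ route-R) holds: §2's interiority at `O₁ = 2` feeds `Prop7ClosedFibreMinimiser.existenceMinimalOrbit_of_interior`
(the direct method, p591314) after the admissibility shrink of `a′₁`, and §1 spreads the single `B₃` over all `B₃ > 4`.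
[cite: Balaban1985Variational, Prop. 7 p.299, Prop. 8 and Sect. F p.304, (14) p.280; Balaban1985Averaging, (53) p.26] -/
theorem existenceMinimalOrbit_of_closedHalving
    (hCH : ∀ L : ℕ, 1 < L → ∃ B₃ a₅ : ℝ, 0 < B₃ ∧ 0 < a₅ ∧
      ∀ F : T3Family, F.L = L → ∀ (n K : ℕ) (hnK : n < K) (ε₀ ε₁ : ℝ), 0 < ε₁ → 0 < ε₀ → ε₀ ≤ a₅ →
        ∀ V : GaugeField (F.P n) 0 (Matrix.specialUnitaryGroup (Fin 2) ℂ), PlaqSmall ε₁ V →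
          ∀ Ū : GaugeField (F.P K) 0 (Matrix.specialUnitaryGroup (Fin 2) ℂ),
            Ū ∈ {U : GaugeField (F.P K) 0 (Matrix.specialUnitaryGroup (Fin 2) ℂ) | ∀ p : Plaq (F.P K) 0,
                  GaugeGroup.dist1 (GaugeField.plaqHol U p) ≤ regThreshold F n K ε₀} ∩ descendTo F ℰp n K hnK.le ⁻¹' {V} ∩
                {U | ∀ b : PBond (F.P K) 0, ‖covDivT 1 (unitsField (toUField U)) b.dir b.src‖ ≤ ε₀ * ((F.L : ℝ)⁻¹) ^ (3 * (K - n))} →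
            IsMinOn (fun W : GaugeField (F.P K) 0 (Matrix.specialUnitaryGroup (Fin 2) ℂ) => wilsonAction4 W)
              ({U : GaugeField (F.P K) 0 (Matrix.specialUnitaryGroup (Fin 2) ℂ) | ∀ p : Plaq (F.P K) 0,
                  GaugeGroup.dist1 (GaugeField.plaqHol U p) ≤ regThreshold F n K ε₀} ∩ descendTo F ℰp n K hnK.le ⁻¹' {V} ∩
                {U | ∀ b : PBond (F.P K) 0, ‖covDivT 1 (unitsField (toUField U)) b.dir b.src‖ ≤ ε₀ * ((F.L : ℝ)⁻¹) ^ (3 * (K - n))}) Ū →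
            RegPr F n K (max (B₃ * ε₁) (ε₀ / 2)) Ū) :
    ∀ L : ℕ, 1 < L → ∀ B₃ : ℝ, 4 < B₃ → ∃ a₁' O₁ : ℝ, 0 < a₁' ∧ 1 ≤ O₁ ∧
      ∀ F : T3Family, F.L = L → ∀ (n K : ℕ) (hnK : n < K) (ε₁ : ℝ), 0 < ε₁ →
        ∀ V : GaugeField (F.P n) 0 (Matrix.specialUnitaryGroup (Fin 2) ℂ), PlaqSmall ε₁ V →
          ∀ U₀ : GaugeField (F.P K) 0 (Matrix.specialUnitaryGroup (Fin 2) ℂ), RegPr F n K ((L : ℝ) ^ 3 * B₃ * ε₁) U₀ →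
            U₀ ∈ fibre F ℰp n K hnK.le V → ε₁ ≤ a₁' →
              ∃ U ∈ regFibrePr F n K hnK.le (O₁ * (L : ℝ) ^ 3 * B₃ * ε₁) V,
                IsMinOn (fun W : GaugeField (F.P K) 0 (Matrix.specialUnitaryGroup (Fin 2) ℂ) => wilsonAction4 W)
                  (regFibrePr F n K hnK.le (O₁ * (L : ℝ) ^ 3 * B₃ * ε₁) V) U := by
  refine existenceMinimalOrbit_allB₃_of_one fun L hL => ?_
  obtain ⟨B₃, a₅, hB₃, ha₅, HCH⟩ := hCH L hL
  -- an admissible radius `r(L)` ([Balaban1985Averaging] (53), as in p591314 §4) and `a′₁ = min (a₅/(2L³B₃)) (r/(2L³B₃))`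
  set C : ℝ := 143 * ((((3 + 4 : ℕ) : ℝ)) ^ 2 / 4) ^ 2 with hC
  set M : ℝ := (((3 + 4) * L : ℕ) : ℝ) ^ 2 with hM
  have hCpos : 0 < C := by rw [hC]; positivity
  have hLpos : (0 : ℝ) < L := by exact_mod_cast (by omega : 0 < L)
  have hMpos : 0 < M := by
    rw [hM]
    have : (0 : ℝ) < (((3 + 4) * L : ℕ) : ℝ) := by push_cast; positivity
    positivity
  have hδ := deltaSU_pos (n := Fin 2)
  set r : ℝ := min (1 / (6 * C)) (deltaSU (Fin 2) / (2 * M)) with hr_def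
  have hr : 0 < r := lt_min (by positivity) (by positivity)
  have hr3 : C * (2 * r) ≤ 1 / 3 := by
    calc C * (2 * r) ≤ C * (2 * (1 / (6 * C))) := by gcongr; exact min_le_left _ _
      _ = 1 / 3 := by field_simp; ring
  have hr2 : 2 * (2 * r) ≤ 2 * deltaSU (Fin 2) / M := by
    calc 2 * (2 * r) ≤ 2 * (2 * (deltaSU (Fin 2) / (2 * M))) := by gcongr; exact min_le_right _ _
      _ = 2 * deltaSU (Fin 2) / M := by field_simp
  have hD : 0 < 2 * (L : ℝ) ^ 3 * B₃ := by positivity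
  set a₁' : ℝ := min (a₅ / (2 * (L : ℝ) ^ 3 * B₃)) (r / (2 * (L : ℝ) ^ 3 * B₃)) with ha₁'_def
  have ha₁' : 0 < a₁' := lt_min (div_pos ha₅ hD) (div_pos hr hD)
  have ha₁'le : a₁' ≤ a₅ / (2 * (L : ℝ) ^ 3 * B₃) := min_le_left _ _
  have hwin : 2 * (L : ℝ) ^ 3 * B₃ * a₁' ≤ r := by
    have : a₁' ≤ r / (2 * (L : ℝ) ^ 3 * B₃) := min_le_right _ _
    rwa [le_div_iff₀ hD, mul_comm] at this
  refine ⟨B₃, a₁', 2, hB₃, ha₁', by norm_num, fun F hF n K hnK ε₁ hε₁ V hV U₀ hreg hfib hε₁a => ?_⟩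
  subst hF
  have hA3 : C * (2 * (2 * (F.L : ℝ) ^ 3 * B₃ * a₁')) ≤ 1 / 3 := by
    calc C * (2 * (2 * (F.L : ℝ) ^ 3 * B₃ * a₁')) ≤ C * (2 * r) := by gcongr
      _ ≤ 1 / 3 := hr3
  have hA2 : 2 * (2 * (2 * (F.L : ℝ) ^ 3 * B₃ * a₁')) ≤ 2 * deltaSU (Fin 2) / (((3 + 4) * F.L : ℕ) : ℝ) ^ 2 := by
    calc 2 * (2 * (2 * (F.L : ℝ) ^ 3 * B₃ * a₁')) ≤ 2 * (2 * r) := by gcongr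
      _ ≤ 2 * deltaSU (Fin 2) / M := hr2
  have hI := interior_of_closedHalving F hB₃ (HCH F rfl)
  exact existenceMinimalOrbit_of_interior F hB₃ (by norm_num : (1 : ℝ) ≤ 2) hA3 hA2
    (fun n K hnK ε₁ hε₁ hε₁a V hV U₀ hreg hfib Ū hŪ hmin =>
      hI n K hnK ε₁ hε₁ (hε₁a.trans ha₁'le) V hV U₀ hreg hfib Ū hŪ hmin)
    n K hnK ε₁ hε₁ V hV U₀ hreg hfib hε₁a

end ClosedHalving

/-! ## §3 What the registered (open) halving buys: existence ⇐ one interior closed-fibre minimiser at some radius of `[e, 2e]` -/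

section OpenHalving

variable (F : T3Family) {n K : ℕ} (hnK : n < K)

/-- **EXISTENCE AT RADIUS `e` FROM THE REGISTERED HALVING AND ONE INTERIOR CLOSED-FIBRE MINIMISER AT SOME `σ ∈ [e, 2e]`.**  Let `HalvingNativeAt L a₅ B₃`
hold (= `stub_halvingStep` at its `B₃`, `T3Thm1CarrierNative.halvingStep_famX_iff_native`), `V` a (7)-datum at `ε₁ > 0` with `B₃ε₁ ≤ e`, and let `Ū` minimise
the Wilson action over the CLOSED fibre `(6̄)(σ) ∩ 𝔅_k(V)` at a radius `e ≤ σ ≤ 2e`, `σ ≤ a₅`, with `Ū ∈ 𝔘_k(σ)` (interior).  Then `Ū` is R2-critical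
(`isCritR2_of_interior`), the halving puts it in `𝔘_k(max{B₃ε₁, ½σ}) ⊆ 𝔘_k(e)`, and it minimises over print's OPEN space `(6)(e) ⊆ (6̄)(σ)`: the conclusion
of `stub_existenceMinimalOrbit` at radius `e`.  (The «flat step» case: a closed minimiser at `σ₀ < σ` that still minimises at `σ` is interior at `σ`,
`Prop7ClosedFibreMinimiser.closedRegFibre_subset_regFibrePr`.) [cite: Balaban1985Variational, Prop. 8 p.304, Prop. 7 p.299, (6)-(8) pp.278-279] -/
theorem exists_isMinOn_regFibrePr_of_halving_of_interiorAt {L : ℕ} (hF : F.L = L) {a₅ B₃ e σ ε₁ : ℝ}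
    (hH : HalvingNativeAt L a₅ B₃) (hε₁ : 0 < ε₁) (he : 0 < e) (hBe : B₃ * ε₁ ≤ e) (heσ : e ≤ σ) (hσe : σ ≤ 2 * e) (hσa : σ ≤ a₅)
    {V : GaugeField (F.P n) 0 (Matrix.specialUnitaryGroup (Fin 2) ℂ)} (hV : PlaqSmall ε₁ V)
    {Ū : GaugeField (F.P K) 0 (Matrix.specialUnitaryGroup (Fin 2) ℂ)}
    (hmin : IsMinOn (fun W : GaugeField (F.P K) 0 (Matrix.specialUnitaryGroup (Fin 2) ℂ) => wilsonAction4 W)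
        ({U : GaugeField (F.P K) 0 (Matrix.specialUnitaryGroup (Fin 2) ℂ) | ∀ p : Plaq (F.P K) 0,
            GaugeGroup.dist1 (GaugeField.plaqHol U p) ≤ regThreshold F n K σ} ∩ descendTo F ℰp n K hnK.le ⁻¹' {V} ∩
          {U | ∀ b : PBond (F.P K) 0, ‖covDivT 1 (unitsField (toUField U)) b.dir b.src‖ ≤ σ * ((F.L : ℝ)⁻¹) ^ (3 * (K - n))}) Ū)
    (hfib : Ū ∈ fibre F ℰp n K hnK.le V) (hint : RegPr F n K σ Ū) :
    Ū ∈ regFibrePr F n K hnK.le e V ∧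
      IsMinOn (fun W : GaugeField (F.P K) 0 (Matrix.specialUnitaryGroup (Fin 2) ℂ) => wilsonAction4 W) (regFibrePr F n K hnK.le e V) Ū := by
  have hσ0 : 0 < σ := he.trans_le heσ
  -- `Ū` is R2-critical (an interior closed-fibre minimiser minimises over the open (6)(σ))
  have hcrit : IsCritR2 F n K hnK.le V Ū := isCritR2_of_interior F hnK.le hσ0 hmin hfib hint
  -- the registered halving: `Ū ∈ 𝔘_k(max{B₃ε₁, ½σ}) ⊆ 𝔘_k(e)`
  have hhalf : RegPr F n K (max (B₃ * ε₁) (σ / 2)) Ū := hH F hF n K hnK σ ε₁ hε₁ hσa V Ū hV hint hfib hcrit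
  have hregE : RegPr F n K e Ū := regPr_mono F (max_le hBe (by linarith)) hhalf
  refine ⟨(mem_regFibrePr_iff F).2 ⟨hfib, hregE⟩, ?_⟩
  -- `(6)(e) ⊆ (6)(σ) ⊆ (6̄)(σ)`
  exact hmin.on_subset ((regFibrePr_mono F heσ V).trans (regFibrePr_subset_closedRegFibre F hnK.le σ V))

end OpenHalving

/-! ## §4 ★ Existence from PROP. 8 (v9's `landed_prop8` = `stub_halvingStep` iterated) and interiority at ONE fixed radius -/

section FixedRadius

/-- ★★ **THE REGISTERED EXISTENCE STUB ⇐ PROP. 8 ∧ «THE CLOSED-FIBRE MINIMISER AT ONE FIXED RADIUS IS INTERIOR».**  Hypotheses: `hP8` = v9's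
`landed_prop8` VERBATIM (`∀ L > 1, ∃ B₃ > 4, Prop8Printed B₃ (famX L)` — [Balaban1985Variational] Prop. 8, in the tree a theorem modulo `stub_halvingStep`
by `Prop8Iter.prop8_of_halvingLiteral`), and `hIR` = for every `L > 1`, `B₃ > 4` a threshold `R₁ > 0` such that for EVERY FIXED radius `0 < R ≤ R₁` there is
`a′₁(R) > 0` with: every minimiser of the Wilson action over the CLOSED fibre `(6̄)(R) ∩ 𝔅_k(V)` — `V` a (7)-datum at `0 < ε₁ ≤ a′₁` carrying a background
`U₀ ∈ 𝔘_k(L³B₃ε₁) ∩ 𝔅_k(V)` — lies in the OPEN class `𝔘_k(R)` (interiority at the single radius `R`, data as regular as we please).  CONCLUSION: the text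
of `stub_existenceMinimalOrbit`, with `O₁ = 1`.  Route: `R := min{a₅, R₁, r(L)}` (`a₅` of Prop. 8, `r(L)` (53)-admissible); the direct method (p591314)
gives a minimiser `Ū` over `(6̄)(R)`; `hIR` makes it interior, hence R2-critical (`isCritR2_of_interior`); PROP. 8 sends an R2-critical configuration of
(6)(R), `R ≤ a₅`, over a (7)-datum into (8) = `𝔘_k(B₃ε₁) ⊆ 𝔘_k(L³B₃ε₁)`; and `Ū` minimises over `(6)(L³B₃ε₁) ⊆ (6̄)(R)`.  §1 spreads Prop. 8's `B₃` over all
`B₃ > 4`: on route (β) the stub's residual beyond the registered halving is interiority AT ONE MACROSCOPIC RADIUS. [cite: Balaban1985Variational, Prop. 8 p.304 («We continue this way until we reach the bound B₃ε₁»), Prop. 7 p.299, Thm 1 (8) p.279, (14) p.280] -/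
theorem existenceMinimalOrbit_of_prop8_of_interiorAtR
    (hP8 : ∀ L : ℕ, 1 < L → ∃ B₃ : ℝ, 4 < B₃ ∧ B11.Prop8Printed B₃ (T3Thm1Carrier.famX L))
    (hIR : ∀ L : ℕ, 1 < L → ∀ B₃ : ℝ, 4 < B₃ → ∃ R₁ : ℝ, 0 < R₁ ∧ ∀ R : ℝ, 0 < R → R ≤ R₁ → ∃ a₁' : ℝ, 0 < a₁' ∧
      ∀ F : T3Family, F.L = L → ∀ (n K : ℕ) (hnK : n < K) (ε₁ : ℝ), 0 < ε₁ → ε₁ ≤ a₁' →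
        ∀ V : GaugeField (F.P n) 0 (Matrix.specialUnitaryGroup (Fin 2) ℂ), PlaqSmall ε₁ V →
          ∀ U₀ : GaugeField (F.P K) 0 (Matrix.specialUnitaryGroup (Fin 2) ℂ), RegPr F n K ((L : ℝ) ^ 3 * B₃ * ε₁) U₀ →
            U₀ ∈ fibre F ℰp n K hnK.le V →
            ∀ Ū : GaugeField (F.P K) 0 (Matrix.specialUnitaryGroup (Fin 2) ℂ),
              Ū ∈ {U : GaugeField (F.P K) 0 (Matrix.specialUnitaryGroup (Fin 2) ℂ) | ∀ p : Plaq (F.P K) 0,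
                  GaugeGroup.dist1 (GaugeField.plaqHol U p) ≤ regThreshold F n K R} ∩ descendTo F ℰp n K hnK.le ⁻¹' {V} ∩
                {U | ∀ b : PBond (F.P K) 0, ‖covDivT 1 (unitsField (toUField U)) b.dir b.src‖ ≤ R * ((F.L : ℝ)⁻¹) ^ (3 * (K - n))} →
              IsMinOn (fun W : GaugeField (F.P K) 0 (Matrix.specialUnitaryGroup (Fin 2) ℂ) => wilsonAction4 W)
                ({U : GaugeField (F.P K) 0 (Matrix.specialUnitaryGroup (Fin 2) ℂ) | ∀ p : Plaq (F.P K) 0,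
                  GaugeGroup.dist1 (GaugeField.plaqHol U p) ≤ regThreshold F n K R} ∩ descendTo F ℰp n K hnK.le ⁻¹' {V} ∩
                {U | ∀ b : PBond (F.P K) 0, ‖covDivT 1 (unitsField (toUField U)) b.dir b.src‖ ≤ R * ((F.L : ℝ)⁻¹) ^ (3 * (K - n))}) Ū →
              RegPr F n K R Ū) :
    ∀ L : ℕ, 1 < L → ∀ B₃ : ℝ, 4 < B₃ → ∃ a₁' O₁ : ℝ, 0 < a₁' ∧ 1 ≤ O₁ ∧
      ∀ F : T3Family, F.L = L → ∀ (n K : ℕ) (hnK : n < K) (ε₁ : ℝ), 0 < ε₁ →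
        ∀ V : GaugeField (F.P n) 0 (Matrix.specialUnitaryGroup (Fin 2) ℂ), PlaqSmall ε₁ V →
          ∀ U₀ : GaugeField (F.P K) 0 (Matrix.specialUnitaryGroup (Fin 2) ℂ), RegPr F n K ((L : ℝ) ^ 3 * B₃ * ε₁) U₀ →
            U₀ ∈ fibre F ℰp n K hnK.le V → ε₁ ≤ a₁' →
              ∃ U ∈ regFibrePr F n K hnK.le (O₁ * (L : ℝ) ^ 3 * B₃ * ε₁) V,
                IsMinOn (fun W : GaugeField (F.P K) 0 (Matrix.specialUnitaryGroup (Fin 2) ℂ) => wilsonAction4 W)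
                  (regFibrePr F n K hnK.le (O₁ * (L : ℝ) ^ 3 * B₃ * ε₁) V) U := by
  refine existenceMinimalOrbit_allB₃_of_one fun L hL => ?_
  obtain ⟨B₃, hB₃, hP⟩ := hP8 L hL
  have hB₃0 : 0 < B₃ := by linarith
  obtain ⟨a₅, ha₅, HP8⟩ := T3Thm1CarrierNative.prop8Printed_famX_iff_native.mp hP
  obtain ⟨R₁, hR₁, HIR⟩ := hIR L hL B₃ hB₃
  set C : ℝ := 143 * ((((3 + 4 : ℕ) : ℝ)) ^ 2 / 4) ^ 2 with hC
  set M : ℝ := (((3 + 4) * L : ℕ) : ℝ) ^ 2 with hM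
  have hCpos : 0 < C := by rw [hC]; positivity
  have hLpos : (0 : ℝ) < L := by exact_mod_cast (by omega : 0 < L)
  have hMpos : 0 < M := by
    rw [hM]
    have : (0 : ℝ) < (((3 + 4) * L : ℕ) : ℝ) := by push_cast; positivity
    positivity
  have hδ := deltaSU_pos (n := Fin 2)
  set r : ℝ := min (1 / (6 * C)) (deltaSU (Fin 2) / (2 * M)) with hr_def
  have hr : 0 < r := lt_min (by positivity) (by positivity)
  have hr3 : C * (2 * r) ≤ 1 / 3 := by
    calc C * (2 * r) ≤ C * (2 * (1 / (6 * C))) := by gcongr; exact min_le_left _ _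
      _ = 1 / 3 := by field_simp; ring
  have hr2 : 2 * (2 * r) ≤ 2 * deltaSU (Fin 2) / M := by
    calc 2 * (2 * r) ≤ 2 * (2 * (deltaSU (Fin 2) / (2 * M))) := by gcongr; exact min_le_right _ _
      _ = 2 * deltaSU (Fin 2) / M := by field_simp
  set R : ℝ := min a₅ (min R₁ r) with hR_def
  have hR : 0 < R := lt_min ha₅ (lt_min hR₁ hr)
  have hRa₅ : R ≤ a₅ := min_le_left _ _
  have hRR₁ : R ≤ R₁ := (min_le_right _ _).trans (min_le_left _ _)
  have hRr : R ≤ r := (min_le_right _ _).trans (min_le_right _ _)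
  obtain ⟨a₁', ha₁', HI⟩ := HIR R hR hRR₁
  have hD : 0 < (L : ℝ) ^ 3 * B₃ := by positivity
  refine ⟨B₃, min a₁' (R / ((L : ℝ) ^ 3 * B₃)), 1, hB₃0, lt_min ha₁' (div_pos hR hD), le_rfl,
    fun F hF n K hnK ε₁ hε₁ V hV U₀ hreg hfib hε₁a => ?_⟩
  subst hF
  have hε₁a' : ε₁ ≤ a₁' := hε₁a.trans (min_le_left _ _)
  have hwin : (F.L : ℝ) ^ 3 * B₃ * ε₁ ≤ R := by
    have h1 : ε₁ ≤ R / ((F.L : ℝ) ^ 3 * B₃) := hε₁a.trans (min_le_right _ _)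
    rw [le_div_iff₀ hD] at h1
    linarith
  obtain ⟨Ū, hŪ, hmin, -, -⟩ := exists_isMinOn_closedRegFibre_of_background F hnK.le hr hr3 hr2 hwin hRr hreg hfib
  have hint : RegPr F n K R Ū := HI F rfl n K hnK ε₁ hε₁ hε₁a' V hV U₀ hreg hfib Ū hŪ hmin
  have hcrit : IsCritR2 F n K hnK.le V Ū := isCritR2_of_interior F hnK.le hR hmin hŪ.1.2 hint
  have h8 : RegPr F n K (B₃ * ε₁) Ū := HP8 F rfl n K hnK R ε₁ hε₁ hRa₅ V Ū hV hint hŪ.1.2 hcrit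
  have hL3 : (1 : ℝ) ≤ (F.L : ℝ) ^ 3 := one_le_pow₀ (by exact_mod_cast (by omega : 1 ≤ F.L))
  have hB8 : B₃ * ε₁ ≤ 1 * (F.L : ℝ) ^ 3 * B₃ * ε₁ := by
    have : 0 ≤ B₃ * ε₁ := by positivity
    nlinarith
  have h1R : 1 * (F.L : ℝ) ^ 3 * B₃ * ε₁ ≤ R := by linarith
  refine ⟨Ū, (mem_regFibrePr_iff F).2 ⟨hŪ.1.2, regPr_mono F hB8 h8⟩, ?_⟩
  exact hmin.on_subset ((regFibrePr_mono F h1R V).trans (regFibrePr_subset_closedRegFibre F hnK.le R V))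

end FixedRadius

end Summit.QuantumFields.YangMills.Theorems.Prop7ClosedFibreHalving

end
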